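import Summits.ResolutionOfSingularities.ResolutionOfSingularities.Theorems.HilbertSamuelEliminationSigmaMaxModificationsCorridor3WLadderE1TangentConeTransport
import Summits.ResolutionOfSingularities.ResolutionOfSingularities.Theorems.HilbertSamuelEliminationSigmaMaxModificationsCorridor3WLadderE1NearStepInitialForm
import Summits.ResolutionOfSingularities.ResolutionOfSingularities.Theorems.HilbertSamuelEliminationSigmaMaxModificationsCorridor3WLadderIsoTailsFreeRationalDictionary
import Summits.ResolutionOfSingularities.ResolutionOfSingularities.Theorems.HilbertSamuelEliminationSigmaMaxModificationsCorridor3WLadderIsoTailsFormalFrameAssemblyStep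
import Literature.AlgebraicGeometry.CossartJannsenSaito2020.ProjDirLine
import Literature.AlgebraicGeometry.Resolution.BlowupAlgebraDerivations
import HarnessLib

/-!
# [OURS · L1 W4.2] The `e = 1` door through the arc, step 3a/3 — **ONE STEP OF AN `e = 1` NEAR CHAIN AT A HYPERSURFACE STAGE IS FREE**
# and the hypersurface presentation with a transversal exceptional parameter PROPAGATES (crux `SigmaMaxModifications`
# stmt-ResolutionOfSingularities-18506 / conjunct stmt-…-19249, line `w_ladder`, row `stub_Wlow3M_two` (β); `--supports 19249`, helper)

Stub worker res-L1-w42-stub-3 (gen 5). Sorry-free PROOF file, no definition, no named fact. OURS bookkeeping for the W4.2 crux chain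
(cell res-hironaka); NOT a statement of [Hironaka2017] nor of [CossartJannsenSaito2020]. AI-written; AI review is weaker than expert review.

**`E1Free.exists_presentation_step`** — DATA at the point `x = π(x′)` of a blow-up `π` with centre ideal `𝔪_x` (the reduced point, `IsBlowup`
also for `vanishingIdeal {x}`): a hypersurface presentation `σ : R ↠ 𝒪_{X,x}`, `R` regular local with regular system of parameters `c`,
`ker σ = (h)`, `h ∈ 𝔪^m ∖ 𝔪^{m+1}`, `m ≥ 2`, whose slot `j₀` is TRANSVERSAL: the symbol `X_{j₀}` of `t := c_{j₀}` is off the directrix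
hyperplane `𝒯(J_{𝒪}(σ ∘ c))`; HYPOTHESES `e_x = 1`, `x′ ∈ ℙ(Dir_x)` (`IsOnProjDirectrix`), `H^{(0)}(𝒪_{x′}) = H^{(0)}(𝒪_x)` (near) and
`e_{x′} ≥ 1`. CONCLUSION: (i) the exceptional ideal `𝔪_x·𝒪_{x′}` is `(π♯σ t)` — `x′` lies in the `t`-chart (tree
`map_maximalIdeal_eq_span_of_projDirLiftsInto`); (ii) the same data at `x′`: `σ′ : R′ ↠ 𝒪_{X′,x′}` (res-type-071's
`EmbeddedStep.exists_maximalIdeal_presentation`, rationality from the PROVED `projDir_line`), `ker σ′ = (h′)`, `h′ ∈ 𝔪′^m ∖ 𝔪′^{m+1}`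
(res-D-pv-010's `mem_pow_and_not_mem_pow_succ_of_hilbertSamuelFun_eq`), regular parameters `y′` with `σ′(y′_{j₀}) = π♯σ(t)` and slot `j₀`
TRANSVERSAL AGAIN — by LEMMA O (origin ⇒ `𝒯_x ≤ ⊕_{k≠j₀} κ C̃_k` in the shifted parameters), LEMMA B (`in(h′) = F(Y′) + T·G`), LEMMA T and
the polynomial lemma of step 1/3. Consequence (step 3b): along an `e = 1` near chain out of a hypersurface stage every step is RATIONAL and
NOT A SATELLITE step, so the grade-free H∞-FINAL (`IsoTailsHS.false_of_pointTower_of_freeRationalTail_of_hypersurfaceStage`) applies.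

[OURS · L1 W4.2; AI-written] [cite: CossartJannsenSaito2020, Def. 6.34 (i), Lemma 2.7, Def. 2.18, Thm. 9.3] [cite: CossartPiltant2008, proof of Lemma 4.3 (3)]
-/

set_option linter.dupNamespace false

noncomputable section

open CategoryTheory AlgebraicGeometry TopologicalSpace IsLocalRing MvPolynomial Module
open Literature.RingTheory.MvPolynomial Literature.RingTheory.HilbertSamuel Literature.AlgebraicGeometry.Resolution
open Literature.AlgebraicGeometry.CossartJannsenSaito2020
open Scheme.IdealSheafData
open Summit.ResolutionOfSingularities.ResolutionOfSingularities.Theorems.SigmaMaxModificationsCorridor3.Helpers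
open Summit.ResolutionOfSingularities.ResolutionOfSingularities.Cruxes.SigmaMaxModifications.IdeasL1C5

namespace Summit.ResolutionOfSingularities.ResolutionOfSingularities.Theorems.SigmaMaxModificationsCorridor3.E1Free

universe u

/-! ## Two small readings at the near point -/

/-- **RATIONALITY of a point of `ℙ(Dir)` when `e = 1`** (the PROVED `projDir_line`): `κ(x) → κ(x′)` is onto, in the form (RAT) consumed by
res-type-071's presentation step. [cite: CossartJannsenSaito2020, Def. 6.34 (i), p. 103] -/
theorem residueField_map_surjective_of_isOnProjDirectrix {Y Y' : Scheme.{u}} [IsLocallyNoetherian Y] {π : Y' ⟶ Y}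
    (x' : Y') (hcl : IsClosed ({π x'} : Set Y)) (hπpt : IsBlowup π (vanishingIdeal ⟨{π x'}, hcl⟩))
    (he : Scheme.dirDim Y (π x') = 1) (hon : IsOnProjDirectrix π x') :
    Function.Surjective (IsLocalRing.ResidueField.map (π.stalkMap x').hom) := by
  have hfib : x' ∈ projDirectrixFibre π (π x') := ⟨rfl, hon⟩
  haveI := (projDir_line Y Y' π (π x') hcl hπpt he).2 x' hfib
  have h := (asIso (π.residueFieldMap x')).commRingCatIsoToRingEquiv.surjective
  rwa [RingEquiv.coe_toRingHom_surjective_iff] at h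
  where
  /-- bookkeeping: surjectivity is the same for `e` and `(e : R →+* S)` -/
  RingEquiv.coe_toRingHom_surjective_iff {R S : Type u} [CommRing R] [CommRing S] (e : R ≃+* S) :
      Function.Surjective e ↔ Function.Surjective (e : R →+* S) := Iff.rfl

/-- **(FREE) from TRANSVERSALITY: at a point `x′ ∈ ℙ(Dir_x)` with `e_x = 1`, the exceptional ideal `𝔪_x·𝒪_{x′}` is generated by the image of
ANY parameter `t = x_{j₀}` whose symbol is off the directrix hyperplane** (tree `map_maximalIdeal_eq_span_of_projDirLiftsInto`, read from the
scheme-level `IsOnProjDirectrix`). [cite: CossartJannsenSaito2020, Def. 6.34 (i), p. 103] -/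
theorem map_maximalIdeal_stalkMap_eq_span_of_transversal {Y Y' : Scheme.{u}} [IsLocallyNoetherian Y] {π : Y' ⟶ Y} (x' : Y')
    {d : ℕ} (x : Fin d → Y.presheaf.stalk (π x')) (hx : Ideal.span (Set.range x) = maximalIdeal (Y.presheaf.stalk (π x')))
    (hdA : (maximalIdeal (Y.presheaf.stalk (π x'))).spanFinrank = d) (j₀ : Fin d)
    (he : Scheme.dirDim Y (π x') = 1) (hon : IsOnProjDirectrix π x')
    (htrans : (X j₀ : MvPolynomial (Fin d) (ResidueField (Y.presheaf.stalk (π x')))) ∉ directrixSpace (tangentConeIdeal x hx)) :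
    (maximalIdeal (Y.presheaf.stalk (π x'))).map (π.stalkMap x').hom = Ideal.span {(π.stalkMap x').hom (x j₀)} := by
  classical
  haveI : IsLocalHom (π.stalkMap x').hom := π.toLRSHom.prop x'
  have he_c : directrixDim (tangentConeIdeal x hx) = 1 := by
    rw [← dirDim_eq' (Y.presheaf.stalk (π x')) hdA x hx]; exact he
  -- `x' ∈ ℙ(Dir_x)` in the coordinates `x`
  have hP : ProjDirLiftsInto (π.stalkMap x').hom x hx := by
    have h0 : ProjDirLiftsInto (π.stalkMap x').hom (minGenerators (Y.presheaf.stalk (π x')))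
        (span_range_minGenerators (Y.presheaf.stalk (π x'))) := hon
    have hsurj : Function.Surjective (Fin.cast hdA.symm) := fun i => ⟨Fin.cast hdA i, by simp⟩
    have hr : Set.range (minGenerators (Y.presheaf.stalk (π x')) ∘ Fin.cast hdA.symm) =
        Set.range (minGenerators (Y.presheaf.stalk (π x'))) := by
      rw [Set.range_comp, hsurj.range_eq, Set.image_univ]
    have hcast : Ideal.span (Set.range (minGenerators (Y.presheaf.stalk (π x')) ∘ Fin.cast hdA.symm)) =
        maximalIdeal (Y.presheaf.stalk (π x')) :=
      (congrArg Ideal.span hr).trans (span_range_minGenerators _)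
    have h1 := (projDirLiftsInto_comp_cast_iff (π.stalkMap x').hom hdA.symm (span_range_minGenerators _) hcast).mpr h0
    exact (projDirLiftsInto_iff_of_minimal_of_isLocalHom (π.stalkMap x').hom hcast hx hdA).mp h1
  have hℓ : linForm (fun i => residue (Y.presheaf.stalk (π x')) ((Pi.single j₀ (1 : Y.presheaf.stalk (π x')) : Fin d → _) i)) ∉
      directrixSpace (tangentConeIdeal x hx) := by
    have hfun : (fun i => residue (Y.presheaf.stalk (π x')) ((Pi.single j₀ (1 : Y.presheaf.stalk (π x')) : Fin d → _) i)) =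
        Pi.single j₀ 1 := by
      funext i
      by_cases hi : i = j₀
      · subst hi; rw [Pi.single_eq_same, Pi.single_eq_same, map_one]
      · rw [Pi.single_eq_of_ne hi, Pi.single_eq_of_ne hi, map_zero]
    rw [hfun, linForm_single]
    exact htrans
  have hta : x j₀ = ∑ i, (Pi.single j₀ (1 : Y.presheaf.stalk (π x')) : Fin d → _) i * x i := by
    rw [Finset.sum_eq_single j₀ (fun k _ hk => by rw [Pi.single_eq_of_ne hk, zero_mul])
      (fun hj => absurd (Finset.mem_univ j₀) hj), Pi.single_eq_same, one_mul]
  have hφm : (maximalIdeal (Y.presheaf.stalk (π x'))).map (π.stalkMap x').hom ≤ maximalIdeal (Y'.presheaf.stalk x') :=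
    ((IsLocalRing.local_hom_TFAE (π.stalkMap x').hom).out 0 2).mp ‹_›
  exact map_maximalIdeal_eq_span_of_projDirLiftsInto hx he_c hta hℓ (π.stalkMap x').hom hφm hP

/-! ## LEMMA S: the directrix bookkeeping of one step, on abstract local rings -/

/-- **LEMMA S — transversality propagates (ring level).** Presentations `σ : R ↠ A` (`ker = (h)`, regular parameters `c`, multiplicity
`m ≥ 2`) and `σ′ : R′ ↠ A′` (`ker = (h′)`, regular parameters `y′`, `h′ ∈ 𝔪′^m ∖ 𝔪′^{m+1}`) linked by local homomorphisms `ι : R → R′`,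
`φ : A → A′` with `σ′ ∘ ι = φ ∘ σ`, the chart relations `y′_{j₀} = ι c̃_{j₀}`, `ι c̃_k = ι c̃_{j₀} · y′_k` for the shifted parameters
`c̃ = shiftRsop c j₀ a`, `ι h = (ι c̃_{j₀})^m h′`, a rational point (`κ(R) → κ(R′)` bijective), `φ σ(c_{j₀})` a non-zero-divisor, the
point on `ℙ(Dir(A))` (`ProjDirLiftsInto φ (σ ∘ c̃)`), `e(A) = 1` and `e(A′) ≥ 1`. THEN the symbol `X_{j₀}` of `y′_{j₀}` is off the
directrix hyperplane of `A′` in the generators `σ′ ∘ y′`. (LEMMA O ⇒ `𝒯((in_{c̃} h)) = ⊕_{k≠j₀}`; LEMMA B ⇒ `in(h′) = F(Y′) + T·G`; LEMMA T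
twice; the polynomial lemma.) [OURS · L1 W4.2; AI-written] [cite: CossartJannsenSaito2020, Lemma 2.7, Def. 2.18, Def. 6.34 (i), Thm. 9.3] -/
theorem X_notMem_directrixSpace_of_stepData {R R' A A' : Type u} [CommRing R] [IsRegularLocalRing R]
    [CommRing R'] [IsRegularLocalRing R'] [CommRing A] [IsLocalRing A] [IsNoetherianRing A]
    [CommRing A'] [IsLocalRing A'] [IsNoetherianRing A']
    {d : ℕ} (hd : (maximalIdeal R).spanFinrank = d) (hd' : (maximalIdeal R').spanFinrank = d)
    (c : Fin d → R) (hc : Ideal.span (Set.range c) = maximalIdeal R) (j₀ : Fin d) (a : {k : Fin d // k ≠ j₀} → R)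
    (y' : Fin d → R') (hy' : Ideal.span (Set.range y') = maximalIdeal R')
    (ι : R →+* R') [IsLocalHom ι] (hκ : Function.Bijective (IsLocalRing.ResidueField.map ι))
    (hyj : y' j₀ = ι (shiftRsop c j₀ a j₀)) (hyk : ∀ k, k ≠ j₀ → ι (shiftRsop c j₀ a k) = ι (shiftRsop c j₀ a j₀) * y' k)
    (σ : R →+* A) (hσ : Function.Surjective σ) {h : R} (hker : RingHom.ker σ = Ideal.span {h})
    {m : ℕ} (hm2 : 2 ≤ m) (hm : h ∈ maximalIdeal R ^ m) (hm' : h ∉ maximalIdeal R ^ (m + 1))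
    (σ' : R' →+* A') (hσ' : Function.Surjective σ') {h' : R'} (hker' : RingHom.ker σ' = Ideal.span {h'})
    (hh'm : h' ∈ maximalIdeal R' ^ m) (hh'm1 : h' ∉ maximalIdeal R' ^ (m + 1))
    (hhh' : ι h = ι (shiftRsop c j₀ a j₀) ^ m * h')
    (φ : A →+* A') (hφ : ∀ r, σ' (ι r) = φ (σ r))
    (hnzd : φ (σ (c j₀)) ∈ nonZeroDivisors A')
    (hPt : ProjDirLiftsInto φ (σ ∘ shiftRsop c j₀ a)
      (span_range_comp_eq_maximalIdeal (by rw [span_range_shiftRsop, hc]) σ hσ))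
    (he : dirDim A = 1) (he' : 1 ≤ dirDim A') :
    (X j₀ : MvPolynomial (Fin d) (ResidueField A')) ∉
      directrixSpace (tangentConeIdeal (σ' ∘ y') (span_range_comp_eq_maximalIdeal hy' σ' hσ')) := by
  classical
  have hd1 : 1 ≤ d := Fin.pos j₀
  set ct := shiftRsop c j₀ a with hctdef
  have hct : Ideal.span (Set.range ct) = maximalIdeal R := by rw [hctdef, span_range_shiftRsop, hc]
  have hctj : ct j₀ = c j₀ := shiftRsop_self c j₀ a
  have hdA : (maximalIdeal A).spanFinrank = d := spanFinrank_maximalIdeal_eq_of_presentation hd σ hσ hker hm2 hm hm' hd1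
  have hdA' : (maximalIdeal A').spanFinrank = d := spanFinrank_maximalIdeal_eq_of_presentation hd' σ' hσ' hker' hm2 hh'm hh'm1 hd1
  have hxAt : Ideal.span (Set.range (σ ∘ ct)) = maximalIdeal A := span_range_comp_eq_maximalIdeal hct σ hσ
  have hxA' : Ideal.span (Set.range (σ' ∘ y')) = maximalIdeal A' := span_range_comp_eq_maximalIdeal hy' σ' hσ'
  -- LEMMA O at `A` in the shifted coordinates
  have horig : ∀ k, k ≠ j₀ → φ ((σ ∘ ct) k) ∈ Ideal.span {φ ((σ ∘ ct) j₀)} * maximalIdeal A' := by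
    intro k hk
    have e1 : φ (σ (ct k)) = φ (σ (ct j₀)) * σ' (y' k) := by rw [← hφ, ← hφ, hyk k hk, map_mul]
    have hykm : y' k ∈ maximalIdeal R' := hy'.le (Ideal.subset_span ⟨k, rfl⟩)
    have hσ'm : σ' (y' k) ∈ maximalIdeal A' := by
      have := Ideal.mem_map_of_mem σ' hykm
      rwa [IsLocalRing.map_maximalIdeal_of_surjective σ' hσ'] at this
    show φ (σ (ct k)) ∈ _
    rw [e1]
    exact Ideal.mul_mem_mul (Ideal.mem_span_singleton_self _) hσ'm
  have hnzd' : φ ((σ ∘ ct) j₀) ∈ nonZeroDivisors A' := by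
    show φ (σ (ct j₀)) ∈ _
    rw [hctj]; exact hnzd
  have hcoef : ∀ L ∈ directrixSpace (tangentConeIdeal (σ ∘ ct) hxAt), MvPolynomial.coeff (Finsupp.single j₀ 1) L = 0 :=
    fun L hL => coeff_eq_zero_of_projDirLiftsInto_origin φ hxAt j₀ horig hnzd' hPt hL
  -- the initial form `F` of `h` in the shifted coordinates and its directrix
  obtain ⟨F, hF⟩ := (initialFormsOf_nonempty_iff ct hct h m).mpr hm
  have hFhom : F.IsHomogeneous m := isHomogeneous_of_mem_initialFormsOf ct hF
  have hF0 : F ≠ 0 := ne_zero_of_mem_initialFormsOf ct hct hF hm'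
  obtain ⟨κ, hκb, hTC⟩ := exists_tangentConeIdeal_eq_map_span_singleton hd ct hct σ hσ hker hm hm' hF hxAt
  have hle : directrixSpace (Ideal.span {F}) ≤ Submodule.span (ResidueField R) (X '' {i | i ≠ j₀}) := by
    refine le_span_X_of_forall_coeff_eq_zero (directrixSpace_le_one _) j₀ fun L hL => ?_
    have hL' : MvPolynomial.map κ L ∈ directrixSpace (tangentConeIdeal (σ ∘ ct) hxAt) := by
      rw [hTC, ← SetLike.mem_coe, coe_directrixSpace_map_of_bijective κ hκb]
      exact ⟨L, hL, rfl⟩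
    have h0 := hcoef _ hL'
    rw [MvPolynomial.coeff_map] at h0
    exact (map_eq_zero_iff κ hκb.1).mp h0
  have hdim : directrixDim (Ideal.span {F}) = 1 := by
    rw [← directrixDim_map_eq_of_bijective κ hκb (Ideal.span {F}), ← hTC, ← dirDim_eq' A hdA (σ ∘ ct) hxAt]
    exact he
  have hTF := directrixSpace_eq_span_X_of_supported hle hdim
  have hFsupp : F ∈ supported (ResidueField R) {i | i ≠ j₀} := by
    have hmem := mem_adjoin_directrixSpace_span_singleton hFhom hF0
    rw [hTF] at hmem
    rwa [← adjoin_span_X]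
  -- LEMMA B: `in(h') = F(Y') + T·G`
  obtain ⟨G, hPmem⟩ := exists_add_X_mul_mem_initialFormsOf ι hd' ct hct j₀ y' hy' hyj hyk (by omega) hhh' hh'm hF hFsupp
  obtain ⟨κ', hκ', hTC'⟩ := exists_tangentConeIdeal_eq_map_span_singleton hd' y' hy' σ' hσ' hker' hh'm hh'm1 hPmem hxA'
  -- the polynomial lemma
  have hP0 : MvPolynomial.map (IsLocalRing.ResidueField.map ι) F + X j₀ * G ≠ 0 :=
    ne_zero_of_mem_initialFormsOf y' hy' hPmem hh'm1
  have hPhom := isHomogeneous_of_mem_initialFormsOf y' hPmem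
  have hF'hom : (MvPolynomial.map (IsLocalRing.ResidueField.map ι) F).IsHomogeneous m := hFhom.map _
  have hF'0 : MvPolynomial.map (IsLocalRing.ResidueField.map ι) F ≠ 0 := fun h0 =>
    hF0 (map_injective _ hκ.1 (by rw [h0, map_zero]))
  have hTF' := directrixSpace_map_eq_span_X (IsLocalRing.ResidueField.map ι) hκ hle hdim
  have hpos : 0 < directrixDim (Ideal.span {MvPolynomial.map (IsLocalRing.ResidueField.map ι) F + X j₀ * G}) := by
    rw [← directrixDim_map_eq_of_bijective κ' hκ' (Ideal.span {_}), ← hTC', ← dirDim_eq' A' hdA' (σ' ∘ y') hxA']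
    exact he'
  have hXP := X_notMem_directrixSpace_of_directrixDim_pos hF'hom hF'0 hTF' hPhom hP0 hpos
  intro hX
  rw [hTC', ← SetLike.mem_coe, coe_directrixSpace_map_of_bijective κ' hκ'] at hX
  obtain ⟨L, hL, hLX⟩ := hX
  have hLj : L = X j₀ := map_injective κ' hκ'.1 (hLX.trans (map_X κ' j₀).symm)
  subst hLj
  exact hXP hL

/-- **ONE `e = 1` NEAR STEP AT A HYPERSURFACE STAGE: the point is in the chart of the transversal parameter, and the hypersurface presentation
with a transversal exceptional slot propagates to the near point** (module docstring). [OURS · L1 W4.2; AI-written]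
[cite: CossartJannsenSaito2020, Def. 6.34 (i), Lemma 2.7, Def. 2.18, Thm. 9.3] [cite: CossartPiltant2008, proof of Lemma 4.3 (3)] -/
theorem exists_presentation_step {Y Y' : Scheme.{u}} [IsLocallyNoetherian Y] [IsLocallyNoetherian Y'] {π : Y' ⟶ Y}
    {D : Y.IdealSheafData} (hπ : IsBlowup π D) (x' : Y')
    (hD : stalkIdeal D (π x') = maximalIdeal (Y.presheaf.stalk (π x')))
    (hcl : IsClosed ({π x'} : Set Y)) (hπpt : IsBlowup π (vanishingIdeal ⟨{π x'}, hcl⟩))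
    {R : Type u} [CommRing R] [IsRegularLocalRing R] {d : ℕ} (hd : (maximalIdeal R).spanFinrank = d)
    (c : Fin d → R) (hc : Ideal.span (Set.range c) = maximalIdeal R)
    (σ : R →+* Y.presheaf.stalk (π x')) (hσ : Function.Surjective σ) {h : R}
    (hker : RingHom.ker σ = Ideal.span {h}) {m : ℕ} (hm2 : 2 ≤ m) (hm : h ∈ maximalIdeal R ^ m)
    (hm' : h ∉ maximalIdeal R ^ (m + 1)) (j₀ : Fin d)
    (he : Scheme.dirDim Y (π x') = 1) (hon : IsOnProjDirectrix π x')
    (hHS : hilbertSamuelFun (Y'.presheaf.stalk x') 0 = hilbertSamuelFun (Y.presheaf.stalk (π x')) 0)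
    (he' : 1 ≤ Scheme.dirDim Y' x')
    (htrans : (X j₀ : MvPolynomial (Fin d) (ResidueField (Y.presheaf.stalk (π x')))) ∉
      directrixSpace (tangentConeIdeal (σ ∘ c) (span_range_comp_eq_maximalIdeal hc σ hσ))) :
    ∃ (R' : Type u) (_ : CommRing R') (_ : IsRegularLocalRing R') (y' : Fin d → R') (σ' : R' →+* Y'.presheaf.stalk x')
      (h' : R') (hy' : Ideal.span (Set.range y') = maximalIdeal R') (hσ' : Function.Surjective σ'),
      (maximalIdeal R').spanFinrank = d ∧ RingHom.ker σ' = Ideal.span {h'} ∧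
      h' ∈ maximalIdeal R' ^ m ∧ h' ∉ maximalIdeal R' ^ (m + 1) ∧
      σ' (y' j₀) = (π.stalkMap x').hom (σ (c j₀)) ∧
      (maximalIdeal (Y.presheaf.stalk (π x'))).map (π.stalkMap x').hom = Ideal.span {(π.stalkMap x').hom (σ (c j₀))} ∧
      (X j₀ : MvPolynomial (Fin d) (ResidueField (Y'.presheaf.stalk x'))) ∉
        directrixSpace (tangentConeIdeal (σ' ∘ y') (span_range_comp_eq_maximalIdeal hy' σ' hσ')) := by
  classical
  have hd1 : 1 ≤ d := Fin.pos j₀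
  have hxA : Ideal.span (Set.range (σ ∘ c)) = maximalIdeal (Y.presheaf.stalk (π x')) := span_range_comp_eq_maximalIdeal hc σ hσ
  have hdA : (maximalIdeal (Y.presheaf.stalk (π x'))).spanFinrank = d :=
    spanFinrank_maximalIdeal_eq_of_presentation hd σ hσ hker hm2 hm hm' hd1
  -- (FREE): `𝔪_x · 𝒪_{x'} = (π♯ σ t)`
  have hE : (maximalIdeal (Y.presheaf.stalk (π x'))).map (π.stalkMap x').hom =
      Ideal.span {(π.stalkMap x').hom (σ (c j₀))} :=
    map_maximalIdeal_stalkMap_eq_span_of_transversal x' (σ ∘ c) hxA hdA j₀ he hon htrans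
  have hfree : ∀ k, (π.stalkMap x').hom (σ (c j₀)) ∣ (π.stalkMap x').hom (σ (c k)) := by
    intro k
    have hk : (π.stalkMap x').hom (σ (c k)) ∈ (maximalIdeal (Y.presheaf.stalk (π x'))).map (π.stalkMap x').hom :=
      Ideal.mem_map_of_mem _ (hxA.le (Ideal.subset_span ⟨k, rfl⟩))
    rw [hE] at hk
    exact Ideal.mem_span_singleton.mp hk
  -- (RAT): `x'` is the `κ(x)`-rational point `ℙ(Dir_x)`
  have hrat : Function.Surjective (IsLocalRing.ResidueField.map (π.stalkMap x').hom) :=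
    residueField_map_surjective_of_isOnProjDirectrix x' hcl hπpt he hon
  haveI : IsLocalHom (π.stalkMap x').hom := π.toLRSHom.prop x'
  -- res-type-071's step: the presentation at `x'`
  obtain ⟨a, 𝔑, h𝔑max, h', σ', h1, h2, h3, h4, h5, h6, h7, h8, h9, h10, h11, h12, h13, h14, h15, h16⟩ :=
    EmbeddedStep.exists_maximalIdeal_presentation c j₀ hπ x' hD hd hc σ hσ hker hm hm' hfree hrat
  haveI : IsRegularLocalRing (Localization.AtPrime 𝔑) := h8
  set ι : R →+* Localization.AtPrime 𝔑 :=
    (algebraMap (blowupAlgebra (maximalIdeal R) (c j₀)) (Localization.AtPrime 𝔑)).comp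
      (algebraMap R (blowupAlgebra (maximalIdeal R) (c j₀))) with hιdef
  -- the new regular system of parameters `y'` (`t` in slot `j₀`)
  have hcm : ∀ k, c k ∈ maximalIdeal R := fun k => hc.le (Ideal.subset_span ⟨k, rfl⟩)
  obtain ⟨y', hy'def⟩ : ∃ y' : Fin d → Localization.AtPrime 𝔑, y' = fun k =>
      if hk : k = j₀ then algebraMap _ (Localization.AtPrime 𝔑) (algebraMap R (blowupAlgebra (maximalIdeal R) (c j₀)) (c j₀))
      else algebraMap _ (Localization.AtPrime 𝔑)
        (blowupAlgebra.gen (maximalIdeal R) (c j₀) (c k) (hc.le (Ideal.subset_span ⟨k, rfl⟩)) -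
          algebraMap R _ (a ⟨k, hk⟩)) := ⟨_, rfl⟩
  have hy' : Ideal.span (Set.range y') = maximalIdeal (Localization.AtPrime 𝔑) := by rw [hy'def]; exact h10
  have hyj : y' j₀ = ι (c j₀) := by rw [hy'def]; exact dif_pos rfl
  have hyk0 : ∀ k (hk : k ≠ j₀), y' k = algebraMap _ (Localization.AtPrime 𝔑)
      (blowupAlgebra.gen (maximalIdeal R) (c j₀) (c k) (hcm k) - algebraMap R _ (a ⟨k, hk⟩)) := fun k hk => by
    rw [hy'def]; exact dif_neg hk
  -- the shifted parameters downstairs: `c̃_k = c_k − a_k t`, so that `ι c̃_k = ι t · y'_k`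
  set ct := shiftRsop c j₀ a with hctdef
  have hct : Ideal.span (Set.range ct) = maximalIdeal R := by rw [hctdef, span_range_shiftRsop, hc]
  have hctj : ct j₀ = c j₀ := shiftRsop_self c j₀ a
  have hyj' : y' j₀ = ι (ct j₀) := by rw [hctj]; exact hyj
  have hyk : ∀ k, k ≠ j₀ → ι (ct k) = ι (ct j₀) * y' k := by
    intro k hk
    have hgen := blowupAlgebra.algebraMap_mul_gen (I := maximalIdeal R) (a := c j₀) (c k) (hcm k)
    rw [hctj, hctdef, shiftRsop_of_ne c j₀ a hk, hyk0 k hk, hιdef]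
    simp only [RingHom.comp_apply, map_sub, map_mul, ← hgen]
    ring
  -- `ι` is local
  haveI : IsLocalHom ι := by
    refine ⟨fun r hr => ?_⟩
    by_contra hru
    have hrm : r ∈ maximalIdeal R := (IsLocalRing.mem_maximalIdeal r).mpr hru
    have hN : algebraMap R (blowupAlgebra (maximalIdeal R) (c j₀)) r ∈ 𝔑 := by
      rw [← Ideal.mem_comap, h4]; exact hrm
    have hιm : ι r ∈ maximalIdeal (Localization.AtPrime 𝔑) := by
      rw [hιdef, RingHom.comp_apply]
      exact (IsLocalization.AtPrime.to_map_mem_maximal_iff (Localization.AtPrime 𝔑) 𝔑 _).mpr hN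
    exact ((IsLocalRing.mem_maximalIdeal _).mp hιm) hr
  -- `h' ≠ 0` in `R'` and its multiplicity
  set h'L : Localization.AtPrime 𝔑 := algebraMap (blowupAlgebra (maximalIdeal R) (c j₀)) _ h' with hh'Ldef
  have hh'ne : h'L ≠ 0 := by
    intro h0
    obtain ⟨s, hs⟩ := (IsLocalization.map_eq_zero_iff 𝔑.primeCompl (Localization.AtPrime 𝔑) h').mp h0
    rcases h2.dvd_or_dvd (show algebraMap R _ (c j₀) ∣ (s : blowupAlgebra (maximalIdeal R) (c j₀)) * h' by
      rw [hs]; exact dvd_zero _) with hd' | hd'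
    · obtain ⟨u, hu⟩ := hd'
      exact s.2 (by rw [hu]; exact Ideal.mul_mem_right _ _ h6)
    · exact h3 hd'
  have hR : ringKrullDim R = ((d : ℕ) : WithBot ℕ∞) := FormalFrame.ringKrullDim_eq_of_spanFinrank_eq hd
  have hR' := @FormalFrame.ringKrullDim_eq_of_spanFinrank_eq (Localization.AtPrime 𝔑) _ h8 d h9
  haveI : IsLocallyNoetherian Y := inferInstance
  obtain ⟨hh'm, hh'm1⟩ := FormalFrame.mem_pow_and_not_mem_pow_succ_of_hilbertSamuelFun_eq hd1 hR hR' σ hσ hker hm hm'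
    σ' h11 h12 hh'ne hHS
  have hhh' : ι h = ι (ct j₀) ^ m * h'L := by
    rw [hctj, hιdef, RingHom.comp_apply, h1, map_mul, map_pow, RingHom.comp_apply]
  have hσ'ι : ∀ r, σ' (ι r) = (π.stalkMap x').hom (σ r) := fun r => by
    rw [hιdef, RingHom.comp_apply]; exact h13 r
  -- `x′ ∈ ℙ(Dir_x)` in the shifted coordinates, rationality, and LEMMA S
  have hxAt : Ideal.span (Set.range (σ ∘ ct)) = maximalIdeal (Y.presheaf.stalk (π x')) :=
    span_range_comp_eq_maximalIdeal hct σ hσ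
  have hPt : ProjDirLiftsInto (π.stalkMap x').hom (σ ∘ ct) hxAt := by
    have h0 : ProjDirLiftsInto (π.stalkMap x').hom (minGenerators (Y.presheaf.stalk (π x')))
        (span_range_minGenerators (Y.presheaf.stalk (π x'))) := hon
    have hsurj : Function.Surjective (Fin.cast hdA.symm) := fun i => ⟨Fin.cast hdA i, by simp⟩
    have hr : Set.range (minGenerators (Y.presheaf.stalk (π x')) ∘ Fin.cast hdA.symm) =
        Set.range (minGenerators (Y.presheaf.stalk (π x'))) := by
      rw [Set.range_comp, hsurj.range_eq, Set.image_univ]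
    have hcast : Ideal.span (Set.range (minGenerators (Y.presheaf.stalk (π x')) ∘ Fin.cast hdA.symm)) =
        maximalIdeal (Y.presheaf.stalk (π x')) :=
      (congrArg Ideal.span hr).trans (span_range_minGenerators _)
    have h1 := (projDirLiftsInto_comp_cast_iff (π.stalkMap x').hom hdA.symm (span_range_minGenerators _) hcast).mpr h0
    exact (projDirLiftsInto_iff_of_minimal_of_isLocalHom (π.stalkMap x').hom hcast hxAt hdA).mp h1
  have hκι : Function.Bijective (IsLocalRing.ResidueField.map (R := R) (S := Localization.AtPrime 𝔑) ι) := by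
    refine ⟨RingHom.injective _, fun z => ?_⟩
    obtain ⟨r, hr⟩ := h16 z
    refine ⟨residue R r, ?_⟩
    rw [ResidueField.map_residue, ← hr, hιdef]
    rfl
  have heA : Literature.RingTheory.HilbertSamuel.dirDim (Y.presheaf.stalk (π x')) = 1 := he
  have heA' : 1 ≤ Literature.RingTheory.HilbertSamuel.dirDim (Y'.presheaf.stalk x') := he'
  have htrans' := @X_notMem_directrixSpace_of_stepData R (Localization.AtPrime 𝔑) (Y.presheaf.stalk (π x'))
    (Y'.presheaf.stalk x') _ _ _ h8 _ _ _ _ _ _ _ hd h9 c hc j₀ a y' hy' ι _ hκι hyj' hyk σ hσ h hker m hm2 hm hm'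
    σ' h11 h'L h12 hh'm hh'm1 hhh' (π.stalkMap x').hom hσ'ι h14 hPt heA heA'
  exact ⟨Localization.AtPrime 𝔑, inferInstance, h8, y', σ', h'L, hy', h11, h9, h12, hh'm, hh'm1, by rw [hyj, hσ'ι], hE, htrans'⟩

end Summit.ResolutionOfSingularities.ResolutionOfSingularities.Theorems.SigmaMaxModificationsCorridor3.E1Free

end
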